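import Literature.NumberTheory.Transcendental.HermiteIntegerPointsRatioTaylor
import Literature.NumberTheory.Transcendental.CijsouwWaldschmidt1977Setup
import Mathlib.Analysis.SpecialFunctions.ExpDeriv
import Mathlib.Analysis.Calculus.IteratedDeriv.Lemmas
import Mathlib.Analysis.Complex.CauchyIntegral
import Mathlib.Analysis.Complex.Exponential
import HarnessLib

/-!
# Cell abc-stewartyu, rung A1.L, WP-L.A parcel P-A5: the ARCHIMEDEAN k-step, TAYLOR-NORMALISED form

`Summits/ABC/StewartYu/ArchG3KStepTaylor.lean` — cell `abc-stewartyu` (HOME `run/shared/lean/pub/abc-stewartyu/`; TRANCHE PLAN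
v1.2 §4′ row P-A5; seat lp-1).  Theorems only; no definition, no named fact.  This is the form of the archimedean k-step the
Gen-3 frame consumes (`ArchG3KStepCore`/`ArchG3KStep` are the un-normalised twins): by the finding of seats p5/lit
(STATUS 2026-08-27 14:34/14:40Z; HOME/lit/WP-LA-SPEC.md §12) the jets of the auxiliary functions must be fed to the Hermite
step as TAYLOR COEFFICIENTS, `|f^{(σ)}(x)| ≤ σ!·Mᵠ·ε` — print's normalisation (Nesterenko 2003, (4.9), Lemma 4.3 (4.19),
(4.20)–(4.23)), under which each derivative costs `log M = log(eBN) + O(1)` and never a height — and the tree's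
`CW77.hermite_*_points_ratio_taylor` / `Hermite.norm_le_of_small_taylor_jets` return the SAME extrapolation bound.
The jets majorant itself (from the zeros at the nodes, the `f − φ` comparison and the differential equations) is the
construction layer's (parcel P-A4, `ArchG3Jets`); here it is the hypothesis `hjet`.

* `norm_iteratedDeriv_twist_le_taylor` — twisted Taylor jets: `|g^{(i)}(x)| ≤ i!·Mⁱ·ε` (`i ≤ σ`, `M ≥ 1`) ⇒
  `|(e^{γz}g)^{(σ)}(x)| ≤ σ!·M^σ·e^{‖γ‖}·e^{‖γ‖‖x‖}·ε` (Leibniz: `Σᵢ C(σ,i)‖γ‖ⁱ(σ−i)!M^{σ−i} ≤ σ! M^σ Σᵢ ‖γ‖ⁱ/i!`).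
* `norm_twist_le_of_taylor_jets_symm` / `norm_le_of_taylor_jets_symm` — the extrapolation at the symmetric nodes `|x| ≤ N`
  for ONE entire function `f` with Taylor jets `≤ σ!·M^σ·ε` there and `‖e^{γz}f(z)‖ ≤ B_G` on `‖z‖ ≤ (3E+1)(2N+1)+N`:
  `‖e^{γw}f(w)‖ ≤ 2(2N+1)^{t+1} t (20e)^{(2N+1)t}·(Mᵗ e^{‖γ‖(N+1)} ε) + B_G·E^{−(2N+1)t}` for `‖w‖ ≤ 3N+2`.
* `norm_twist_le_of_taylor_jets_odd` / `norm_le_of_taylor_jets_odd` — the same at the odd nodes `|x| ≤ 2m−1`.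
* `kstep_symm_taylor` / `kstep_odd_taylor` — the k-steps with the Liouville conclusion `φ τ x₁ = 0` at the new integer points
  (abstract rational values `φ`, denominators `D`, comparison `ε_c`), twins of `ArchKStep.kstep_symm` / `kstep_odd`.

WHAT THIS IS NOT: not the jets majorant, not the sizes `B_G`, `ε`, `ε_c`, `D` of the frame (parcels P-A4/P-A8); no crux moves.

## References
* Yu. V. Nesterenko, LNM 1819 (2003) — §4.1 (4.8)–(4.11), Lemma 4.2 (p. 81–83); §4.2 Lemma 4.3 (4.18)–(4.23) (p. 84–87),
  (4.24)–(4.35) (p. 87–90). [Nesterenko2003]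
* M. Waldschmidt, Acta Arith. 37 (1980) — Lemmas 3.4–3.6 (the tree's `w80_kstep`, the model). [Waldschmidt1980]
-/

noncomputable section

open Finset Real
open Literature.NumberTheory.Transcendental
open Literature.NumberTheory.Transcendental.CW77 (hermite_symm_integer_points_ratio_taylor hermite_odd_points_ratio_taylor)
open Literature.NumberTheory.Transcendental.CW77.Setup (Tau tauNorm)

namespace Summit.ABC.StewartYu

namespace ArchKStep

variable {n : ℕ}

/-! ### Twisted Taylor jets -/

/-- The iterated derivatives of `z ↦ e^{γz}`: `(e^{γz})^{(i)} = γⁱ e^{γz}`. [folklore] -/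
private theorem iteratedDeriv_cexp_mul' (γ : ℂ) (i : ℕ) (x : ℂ) :
    iteratedDeriv i (fun z => Complex.exp (γ * z)) x = γ ^ i * Complex.exp (γ * x) := by
  induction i generalizing x with
  | zero => simp
  | succ i ih =>
    rw [iteratedDeriv_succ]
    have : iteratedDeriv i (fun z => Complex.exp (γ * z)) = fun z => γ ^ i * Complex.exp (γ * z) := funext ih
    rw [this]
    have hd : HasDerivAt (fun z => γ ^ i * Complex.exp (γ * z)) (γ ^ i * (Complex.exp (γ * x) * γ)) x := by
      have h1 : HasDerivAt (fun z => γ * z) γ x := by simpa using (hasDerivAt_id x).const_mul γ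
      exact (h1.cexp).const_mul _
    rw [hd.deriv]; ring

/-- **Leibniz with factorials**: `|u^{(i)}(x)| ≤ aⁱ·A` and `|g^{(i)}(x)| ≤ i!·Mⁱ·ε` for `i ≤ σ` (`a, A, ε ≥ 0`, `M ≥ 1`) give
`|(u·g)^{(σ)}(x)| ≤ σ!·M^σ·e^{a}·A·ε` (`C(σ,i)·(σ−i)! = σ!/i!`, `Σᵢ aⁱ/i! ≤ eᵃ`). [folklore] -/
private theorem norm_iteratedDeriv_mul_le_taylor {u g : ℂ → ℂ} (hu : ContDiff ℂ ⊤ u) (hg : ContDiff ℂ ⊤ g)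
    {x : ℂ} {σ : ℕ} {a A M ε : ℝ} (ha : 0 ≤ a) (hA : 0 ≤ A) (hM : 1 ≤ M) (hε : 0 ≤ ε)
    (hub : ∀ i ≤ σ, ‖iteratedDeriv i u x‖ ≤ a ^ i * A)
    (hgb : ∀ i ≤ σ, ‖iteratedDeriv i g x‖ ≤ i.factorial * (M ^ i * ε)) :
    ‖iteratedDeriv σ (u * g) x‖ ≤ σ.factorial * (M ^ σ * (Real.exp a * A * ε)) := by
  rw [iteratedDeriv_mul (hu.contDiffAt.of_le le_top) (hg.contDiffAt.of_le le_top)]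
  have hM0 : 0 ≤ M := le_trans zero_le_one hM
  -- termwise: `C(σ,i) aⁱ A (σ−i)! M^{σ−i} ε ≤ σ! M^σ A ε · aⁱ/i!`
  have hterm : ∀ i ∈ range (σ + 1),
      ‖(σ.choose i : ℂ) * iteratedDeriv i u x * iteratedDeriv (σ - i) g x‖ ≤
        σ.factorial * (M ^ σ * (A * ε)) * (a ^ i / i.factorial) := by
    intro i hi
    have hik : i ≤ σ := Nat.lt_succ_iff.mp (mem_range.mp hi)
    rw [norm_mul, norm_mul, Complex.norm_natCast]
    have h1 := hub i hik
    have h2 := hgb (σ - i) (Nat.sub_le _ _)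
    have hif : (0 : ℝ) < i.factorial := by exact_mod_cast Nat.factorial_pos i
    have hchoose : (σ.choose i : ℝ) * i.factorial * (σ - i).factorial = σ.factorial := by
      exact_mod_cast Nat.choose_mul_factorial_mul_factorial hik
    have hMpow : M ^ (σ - i) ≤ M ^ σ := pow_le_pow_right₀ hM (Nat.sub_le _ _)
    calc (σ.choose i : ℝ) * ‖iteratedDeriv i u x‖ * ‖iteratedDeriv (σ - i) g x‖
        ≤ (σ.choose i : ℝ) * (a ^ i * A) * ((σ - i).factorial * (M ^ (σ - i) * ε)) :=
          mul_le_mul (mul_le_mul_of_nonneg_left h1 (Nat.cast_nonneg _)) h2 (norm_nonneg _) (by positivity)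
      _ ≤ (σ.choose i : ℝ) * (a ^ i * A) * ((σ - i).factorial * (M ^ σ * ε)) := by
          gcongr
      _ = ((σ.choose i : ℝ) * i.factorial * (σ - i).factorial) * (M ^ σ * (A * ε)) * (a ^ i / i.factorial) := by
          field_simp
      _ = σ.factorial * (M ^ σ * (A * ε)) * (a ^ i / i.factorial) := by rw [hchoose]
  calc ‖∑ i ∈ range (σ + 1), (σ.choose i : ℂ) * iteratedDeriv i u x * iteratedDeriv (σ - i) g x‖
      ≤ ∑ i ∈ range (σ + 1), ‖(σ.choose i : ℂ) * iteratedDeriv i u x * iteratedDeriv (σ - i) g x‖ := norm_sum_le _ _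
    _ ≤ ∑ i ∈ range (σ + 1), σ.factorial * (M ^ σ * (A * ε)) * (a ^ i / i.factorial) := sum_le_sum hterm
    _ = σ.factorial * (M ^ σ * (A * ε)) * ∑ i ∈ range (σ + 1), a ^ i / i.factorial := by rw [mul_sum]
    _ ≤ σ.factorial * (M ^ σ * (A * ε)) * Real.exp a :=
        mul_le_mul_of_nonneg_left (Real.sum_le_exp_of_nonneg ha _) (by positivity)
    _ = σ.factorial * (M ^ σ * (Real.exp a * A * ε)) := by ring

/-- **Twisted Taylor jets**: if `g` is entire and `|g^{(i)}(x)| ≤ i!·Mⁱ·ε` for `i ≤ σ` (`M ≥ 1`, `ε ≥ 0`), then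
`|(e^{γz} g)^{(σ)}(x)| ≤ σ!·M^σ·e^{‖γ‖}·e^{‖γ‖‖x‖}·ε` — in Taylor-normalised currency the twist factor costs `‖γ‖(‖x‖ + 1)`,
independently of `σ`. [folklore] -/
theorem norm_iteratedDeriv_twist_le_taylor {g : ℂ → ℂ} (hg : Differentiable ℂ g) (γ x : ℂ) {σ : ℕ} {M ε : ℝ}
    (hM : 1 ≤ M) (hε : 0 ≤ ε) (hgb : ∀ i ≤ σ, ‖iteratedDeriv i g x‖ ≤ i.factorial * (M ^ i * ε)) :
    ‖iteratedDeriv σ (fun z => Complex.exp (γ * z) * g z) x‖ ≤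
      σ.factorial * (M ^ σ * (Real.exp ‖γ‖ * Real.exp (‖γ‖ * ‖x‖) * ε)) := by
  have hu : ContDiff ℂ ⊤ (fun z => Complex.exp (γ * z)) := by fun_prop
  have hub : ∀ i ≤ σ, ‖iteratedDeriv i (fun z => Complex.exp (γ * z)) x‖ ≤ ‖γ‖ ^ i * Real.exp (‖γ‖ * ‖x‖) := by
    intro i _
    rw [iteratedDeriv_cexp_mul', norm_mul, norm_pow, Complex.norm_exp]
    refine mul_le_mul_of_nonneg_left (Real.exp_le_exp.mpr ?_) (by positivity)
    calc (γ * x).re ≤ ‖γ * x‖ := Complex.re_le_norm _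
      _ = ‖γ‖ * ‖x‖ := norm_mul _ _
  have key := norm_iteratedDeriv_mul_le_taylor hu hg.contDiff (norm_nonneg γ) (Real.exp_pos _).le hM hε hub hgb
  have e : ((fun z => Complex.exp (γ * z)) * g) = fun z => Complex.exp (γ * z) * g z := rfl
  rw [e] at key
  exact key

/-! ### The extrapolation at the symmetric nodes, Taylor-normalised jets -/

/-- **Archimedean extrapolation at the symmetric nodes, Taylor form** (one entire function).  If
`|f^{(σ)}(x)| ≤ σ!·M^σ·ε` at the integers `|x| ≤ N` for `σ < t` (`t ≥ 1`, `M ≥ 1`, `ε ≥ 0`), `E ≥ 1`, and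
`‖e^{γz}f(z)‖ ≤ B_G` on `‖z‖ ≤ (3E+1)(2N+1) + N`, then for `‖w‖ ≤ 3N + 2`:
`‖e^{γw}f(w)‖ ≤ 2(2N+1)^{t+1} t (20e)^{(2N+1)t}·(Mᵗ·e^{‖γ‖(N+1)}·ε) + B_G·(1/E)^{(2N+1)t}`.
[cite: Nesterenko2003, §4.1 (4.8)–(4.11), Lemma 4.2; §4.2 (4.19), (4.24)–(4.32), p. 81–89] -/
theorem norm_twist_le_of_taylor_jets_symm {f : ℂ → ℂ} (hf : Differentiable ℂ f) (γ : ℂ) (N : ℕ) {t : ℕ}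
    (ht : 1 ≤ t) {M ε BG E : ℝ} (hM : 1 ≤ M) (hε : 0 ≤ ε) (hE : 1 ≤ E)
    (hjet : ∀ x : ℤ, |x| ≤ (N : ℤ) → ∀ σ, σ < t → ‖iteratedDeriv σ f (x : ℂ)‖ ≤ σ.factorial * (M ^ σ * ε))
    (hBG : ∀ z : ℂ, ‖z‖ ≤ (3 * E + 1) * (2 * N + 1) + N → ‖Complex.exp (γ * z) * f z‖ ≤ BG)
    {w : ℂ} (hw : ‖w‖ ≤ 3 * N + 2) :
    ‖Complex.exp (γ * w) * f w‖ ≤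
      2 * ((2 * N + 1 : ℕ) : ℝ) ^ (t + 1) * t * (20 * Real.exp 1) ^ ((2 * N + 1) * t) *
          (M ^ t * Real.exp (‖γ‖ * (N + 1)) * ε) +
        BG * (1 / E) ^ ((2 * N + 1) * t) := by
  set G : ℂ → ℂ := fun z => Complex.exp (γ * z) * f z with hG
  have hGd : Differentiable ℂ G := by
    have h1 : Differentiable ℂ (fun z : ℂ => Complex.exp (γ * z)) := by fun_prop
    exact h1.mul hf
  set εH : ℝ := M ^ t * Real.exp (‖γ‖ * (N + 1)) * ε with hεH
  have hM0 : 0 ≤ M := le_trans zero_le_one hM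
  have hεH0 : 0 ≤ εH := by positivity
  have hjetG : ∀ j : ℤ, |j| ≤ (N : ℤ) → ∀ σ, σ < t → ‖iteratedDeriv σ G (j : ℂ)‖ ≤ σ.factorial * εH := by
    intro j hj σ hσ
    have h := norm_iteratedDeriv_twist_le_taylor hf γ (j : ℂ) (σ := σ) hM hε
      (fun i hi => hjet j hj i (by omega))
    refine h.trans (mul_le_mul_of_nonneg_left ?_ (Nat.cast_nonneg _))
    have hjn : ‖(j : ℂ)‖ ≤ N := by rw [Complex.norm_intCast]; exact_mod_cast hj
    have hexp : Real.exp ‖γ‖ * Real.exp (‖γ‖ * ‖(j : ℂ)‖) ≤ Real.exp (‖γ‖ * (N + 1)) := by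
      rw [← Real.exp_add]
      refine Real.exp_le_exp.mpr ?_
      nlinarith [norm_nonneg γ, norm_nonneg (j : ℂ)]
    calc M ^ σ * (Real.exp ‖γ‖ * Real.exp (‖γ‖ * ‖(j : ℂ)‖) * ε)
        ≤ M ^ t * (Real.exp (‖γ‖ * (N + 1)) * ε) :=
          mul_le_mul (pow_le_pow_right₀ hM hσ.le) (mul_le_mul_of_nonneg_right hexp hε) (by positivity)
            (by positivity)
      _ = εH := by rw [hεH]; ring
  exact hermite_symm_integer_points_ratio_taylor hGd N ht hεH0 hE hjetG hBG hw

/-- **The untwisted value, Taylor form**: under the hypotheses of `norm_twist_le_of_taylor_jets_symm`, for `‖w‖ ≤ 3N+2`,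
`‖f(w)‖ ≤ e^{‖γ‖‖w‖}·(2(2N+1)^{t+1} t (20e)^{(2N+1)t}(Mᵗ e^{‖γ‖(N+1)} ε) + B_G (1/E)^{(2N+1)t})`.
[cite: Nesterenko2003, §4.1 Lemma 4.2; §4.2 (4.24)–(4.32), p. 82–89] -/
theorem norm_le_of_taylor_jets_symm {f : ℂ → ℂ} (hf : Differentiable ℂ f) (γ : ℂ) (N : ℕ) {t : ℕ}
    (ht : 1 ≤ t) {M ε BG E : ℝ} (hM : 1 ≤ M) (hε : 0 ≤ ε) (hE : 1 ≤ E)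
    (hjet : ∀ x : ℤ, |x| ≤ (N : ℤ) → ∀ σ, σ < t → ‖iteratedDeriv σ f (x : ℂ)‖ ≤ σ.factorial * (M ^ σ * ε))
    (hBG : ∀ z : ℂ, ‖z‖ ≤ (3 * E + 1) * (2 * N + 1) + N → ‖Complex.exp (γ * z) * f z‖ ≤ BG)
    {w : ℂ} (hw : ‖w‖ ≤ 3 * N + 2) :
    ‖f w‖ ≤ Real.exp (‖γ‖ * ‖w‖) *
      (2 * ((2 * N + 1 : ℕ) : ℝ) ^ (t + 1) * t * (20 * Real.exp 1) ^ ((2 * N + 1) * t) *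
          (M ^ t * Real.exp (‖γ‖ * (N + 1)) * ε) +
        BG * (1 / E) ^ ((2 * N + 1) * t)) := by
  have h := norm_twist_le_of_taylor_jets_symm hf γ N ht hM hε hE hjet hBG hw
  have e : f w = Complex.exp (-(γ * w)) * (Complex.exp (γ * w) * f w) := by
    rw [← mul_assoc, ← Complex.exp_add, neg_add_cancel, Complex.exp_zero, one_mul]
  rw [e, norm_mul]
  refine mul_le_mul ?_ h (norm_nonneg _) (Real.exp_pos _).le
  rw [Complex.norm_exp]
  refine Real.exp_le_exp.mpr ?_
  calc (-(γ * w)).re ≤ ‖-(γ * w)‖ := Complex.re_le_norm _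
    _ = ‖γ‖ * ‖w‖ := by rw [norm_neg, norm_mul]

/-! ### The extrapolation at the odd nodes, Taylor-normalised jets -/

/-- **Archimedean extrapolation at the odd nodes, Taylor form** (one entire function; Nesterenko's `𝒳_{s,0}`).  If
`|f^{(σ)}(x)| ≤ σ!·M^σ·ε` at the ODD integers `|x| ≤ 2m − 1` (`m ≥ 1`) for `σ < t`, and `‖e^{γz}f(z)‖ ≤ B_G` on `‖z‖ ≤ (12E+6)m`,
then for `‖w‖ ≤ 6m`: `‖e^{γw}f(w)‖ ≤ 2(2m)^{t+1} t (20e)^{2mt}·2ᵗ(Mᵗ e^{2m‖γ‖} ε) + B_G (1/E)^{2mt}`.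
[cite: Nesterenko2003, §4.1 Lemma 4.2; §4.2 (4.19) with the nodes 𝒳_{s,0}, §4.3 (4.36), p. 82–90] -/
theorem norm_twist_le_of_taylor_jets_odd {f : ℂ → ℂ} (hf : Differentiable ℂ f) (γ : ℂ) {m t : ℕ} (hm : 1 ≤ m)
    (ht : 1 ≤ t) {M ε BG E : ℝ} (hM : 1 ≤ M) (hε : 0 ≤ ε) (hE : 1 ≤ E)
    (hjet : ∀ x : ℤ, Odd x → |x| ≤ 2 * (m : ℤ) - 1 → ∀ σ, σ < t →
      ‖iteratedDeriv σ f (x : ℂ)‖ ≤ σ.factorial * (M ^ σ * ε))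
    (hBG : ∀ z : ℂ, ‖z‖ ≤ (12 * E + 6) * m → ‖Complex.exp (γ * z) * f z‖ ≤ BG)
    {w : ℂ} (hw : ‖w‖ ≤ 6 * m) :
    ‖Complex.exp (γ * w) * f w‖ ≤
      2 * ((2 * m : ℕ) : ℝ) ^ (t + 1) * t * (20 * Real.exp 1) ^ ((2 * m) * t) *
          (2 ^ t * (M ^ t * Real.exp (‖γ‖ * (2 * m)) * ε)) +
        BG * (1 / E) ^ ((2 * m) * t) := by
  set G : ℂ → ℂ := fun z => Complex.exp (γ * z) * f z with hG
  have hGd : Differentiable ℂ G := by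
    have h1 : Differentiable ℂ (fun z : ℂ => Complex.exp (γ * z)) := by fun_prop
    exact h1.mul hf
  set εH : ℝ := M ^ t * Real.exp (‖γ‖ * (2 * m)) * ε with hεH
  have hM0 : 0 ≤ M := le_trans zero_le_one hM
  have hεH0 : 0 ≤ εH := by positivity
  have hjetG : ∀ x : ℤ, Odd x → |x| ≤ 2 * (m : ℤ) - 1 → ∀ σ, σ < t →
      ‖iteratedDeriv σ G (x : ℂ)‖ ≤ σ.factorial * εH := by
    intro x hxo hx σ hσ
    have h := norm_iteratedDeriv_twist_le_taylor hf γ (x : ℂ) (σ := σ) hM hε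
      (fun i hi => hjet x hxo hx i (by omega))
    refine h.trans (mul_le_mul_of_nonneg_left ?_ (Nat.cast_nonneg _))
    have hxn : ‖(x : ℂ)‖ ≤ 2 * m - 1 := by rw [Complex.norm_intCast]; exact_mod_cast hx
    have hexp : Real.exp ‖γ‖ * Real.exp (‖γ‖ * ‖(x : ℂ)‖) ≤ Real.exp (‖γ‖ * (2 * m)) := by
      rw [← Real.exp_add]
      refine Real.exp_le_exp.mpr ?_
      nlinarith [norm_nonneg γ, norm_nonneg (x : ℂ)]
    calc M ^ σ * (Real.exp ‖γ‖ * Real.exp (‖γ‖ * ‖(x : ℂ)‖) * ε)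
        ≤ M ^ t * (Real.exp (‖γ‖ * (2 * m)) * ε) :=
          mul_le_mul (pow_le_pow_right₀ hM hσ.le) (mul_le_mul_of_nonneg_right hexp hε) (by positivity)
            (by positivity)
      _ = εH := by rw [hεH]; ring
  exact hermite_odd_points_ratio_taylor hGd hm ht hεH0 hE hjetG hBG hw

/-- **The untwisted value at the odd-node step, Taylor form**: `‖f(w)‖ ≤ e^{‖γ‖‖w‖}·(…)` for `‖w‖ ≤ 6m` under the hypotheses
of `norm_twist_le_of_taylor_jets_odd`. [cite: Nesterenko2003, §4.1 Lemma 4.2; §4.2 with the nodes 𝒳_{s,0}, p. 82–89] -/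
theorem norm_le_of_taylor_jets_odd {f : ℂ → ℂ} (hf : Differentiable ℂ f) (γ : ℂ) {m t : ℕ} (hm : 1 ≤ m)
    (ht : 1 ≤ t) {M ε BG E : ℝ} (hM : 1 ≤ M) (hε : 0 ≤ ε) (hE : 1 ≤ E)
    (hjet : ∀ x : ℤ, Odd x → |x| ≤ 2 * (m : ℤ) - 1 → ∀ σ, σ < t →
      ‖iteratedDeriv σ f (x : ℂ)‖ ≤ σ.factorial * (M ^ σ * ε))
    (hBG : ∀ z : ℂ, ‖z‖ ≤ (12 * E + 6) * m → ‖Complex.exp (γ * z) * f z‖ ≤ BG)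
    {w : ℂ} (hw : ‖w‖ ≤ 6 * m) :
    ‖f w‖ ≤ Real.exp (‖γ‖ * ‖w‖) *
      (2 * ((2 * m : ℕ) : ℝ) ^ (t + 1) * t * (20 * Real.exp 1) ^ ((2 * m) * t) *
          (2 ^ t * (M ^ t * Real.exp (‖γ‖ * (2 * m)) * ε)) +
        BG * (1 / E) ^ ((2 * m) * t)) := by
  have h := norm_twist_le_of_taylor_jets_odd hf γ hm ht hM hε hE hjet hBG hw
  have e : f w = Complex.exp (-(γ * w)) * (Complex.exp (γ * w) * f w) := by
    rw [← mul_assoc, ← Complex.exp_add, neg_add_cancel, Complex.exp_zero, one_mul]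
  rw [e, norm_mul]
  refine mul_le_mul ?_ h (norm_nonneg _) (Real.exp_pos _).le
  rw [Complex.norm_exp]
  refine Real.exp_le_exp.mpr ?_
  calc (-(γ * w)).re ≤ ‖-(γ * w)‖ := Complex.re_le_norm _
    _ = ‖γ‖ * ‖w‖ := by rw [norm_neg, norm_mul]

/-! ### The k-steps with the Liouville conclusion, Taylor-normalised jets -/

/-- A rational number with a known denominator multiple `D ≥ 1` and absolute value `< 1/D` vanishes.
[cite: Waldschmidt1980, Lemma 3.4 (3.21)] -/
private theorem rat_eq_zero_of_abs_lt' {q : ℚ} {D : ℕ} (hD : 1 ≤ D) (hz : ∃ z : ℤ, (D : ℚ) * q = z)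
    (hlt : |(q : ℝ)| < 1 / (D : ℝ)) : q = 0 := by
  obtain ⟨z, hz⟩ := hz
  by_contra hne
  have hD0 : (0 : ℝ) < D := by exact_mod_cast (show 0 < D by omega)
  have hz0 : z ≠ 0 := by
    rintro rfl
    rw [Int.cast_zero, mul_eq_zero] at hz
    rcases hz with h0 | h0
    · exact absurd (by exact_mod_cast h0 : D = 0) (by omega)
    · exact hne h0
  have hz1 : (1 : ℝ) ≤ |(z : ℝ)| := by exact_mod_cast Int.one_le_abs hz0
  have hq : (q : ℝ) = (z : ℝ) / (D : ℝ) := by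
    have h' : (D : ℝ) * (q : ℝ) = (z : ℝ) := by exact_mod_cast hz
    field_simp; linarith
  have hge : 1 / (D : ℝ) ≤ |(q : ℝ)| := by
    rw [hq, abs_div, abs_of_pos hD0]
    exact div_le_div_of_nonneg_right hz1 hD0.le
  linarith

/-- From `‖F − φ‖ ≤ ε_c` and `‖F‖ ≤ A`: `|φ| ≤ A + ε_c`. [folklore] -/
private theorem abs_ratCast_le_of_norm_sub_le' {u : ℂ} {q : ℚ} {A εc : ℝ} (hA : ‖u‖ ≤ A)
    (hcmp : ‖u - ((q : ℚ) : ℂ)‖ ≤ εc) : |(q : ℝ)| ≤ A + εc := by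
  have h1 : ‖((q : ℚ) : ℂ)‖ ≤ ‖u‖ + ‖u - ((q : ℚ) : ℂ)‖ := by
    calc ‖((q : ℚ) : ℂ)‖ = ‖u - (u - ((q : ℚ) : ℂ))‖ := by rw [sub_sub_cancel]
      _ ≤ ‖u‖ + ‖u - ((q : ℚ) : ℂ)‖ := norm_sub_le u (u - ((q : ℚ) : ℂ))
  have h2 : ‖((q : ℚ) : ℂ)‖ = |(q : ℝ)| := by
    rw [← Complex.ofReal_ratCast, Complex.norm_real, Real.norm_eq_abs]
  rw [← h2]; linarith

/-- **The archimedean k-step, symmetric nodes, Taylor-normalised jets** (twin of `G3Setup.LvInvI.kstep` / `g3_kstep_pm`;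
Nesterenko's `𝒳_{s,ν} → 𝒳_{s,ν+1}`).  Data: a family `F : Tau n → ℂ → ℂ` of entire functions, a twist `γ`, a ratio
`E ≥ 1`, rational values `φ τ x` with denominators `D x τ ≥ 1` (`D·φ ∈ ℤ`).  Hypotheses, for every `τ` with `|τ| + t ≤ Tlo`:
the Taylor jets `|(F τ)^{(σ)}(x)| ≤ σ!·M^σ·ε` at the nodes `|x| ≤ N` for `σ < t` (the frame derives them from the zeros
`φ τ'' x = 0`, `|τ''| < Tlo`, the `f − φ` comparison and its normalised jets majorant); the growth `‖e^{γz}F τ z‖ ≤ B_G` on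
`‖z‖ ≤ (3E+1)(2N+1)+N`; the comparison `‖F τ x₁ − φ τ x₁‖ ≤ ε_c` at the new points `|x₁| ≤ N′ ≤ 3N+2`; and
`e^{‖γ‖N′}·(2(2N+1)^{t+1} t (20e)^{(2N+1)t}(Mᵗ e^{‖γ‖(N+1)} ε) + B_G E^{−(2N+1)t}) + ε_c < 1/D x₁ τ`.
Conclusion: `φ τ x₁ = 0` for `|x₁| ≤ N′`, `|τ| + t ≤ Tlo`.
[cite: Nesterenko2003, §4.2 Lemma 4.3, (4.24)–(4.35), p. 84–90] [cite: Waldschmidt1980, Lemma 3.6] -/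
theorem kstep_symm_taylor (F : Tau n → ℂ → ℂ) {Tlo t : ℕ} (hdiff : ∀ τ, tauNorm τ + t ≤ Tlo → Differentiable ℂ (F τ))
    (γ : ℂ) {N N' : ℕ} (hN' : N' ≤ 3 * N + 2) (ht : 1 ≤ t) {M ε εc BG E : ℝ} (hM : 1 ≤ M) (hε : 0 ≤ ε)
    (hE : 1 ≤ E) (φ : Tau n → ℤ → ℚ)
    (hjet : ∀ τ : Tau n, tauNorm τ + t ≤ Tlo → ∀ x : ℤ, |x| ≤ (N : ℤ) → ∀ σ, σ < t →
      ‖iteratedDeriv σ (F τ) (x : ℂ)‖ ≤ σ.factorial * (M ^ σ * ε))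
    (hBG : ∀ τ : Tau n, tauNorm τ + t ≤ Tlo →
      ∀ z : ℂ, ‖z‖ ≤ (3 * E + 1) * (2 * N + 1) + N → ‖Complex.exp (γ * z) * F τ z‖ ≤ BG)
    (hcmp : ∀ x₁ : ℤ, |x₁| ≤ (N' : ℤ) → ∀ τ : Tau n, tauNorm τ + t ≤ Tlo →
      ‖F τ (x₁ : ℂ) - ((φ τ x₁ : ℚ) : ℂ)‖ ≤ εc)
    (D : ℤ → Tau n → ℕ) (hD : ∀ x τ, 1 ≤ D x τ) (hden : ∀ x τ, ∃ z : ℤ, (D x τ : ℚ) * φ τ x = z)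
    (hfinal : ∀ x₁ : ℤ, |x₁| ≤ (N' : ℤ) → ∀ τ : Tau n, tauNorm τ + t ≤ Tlo →
      Real.exp (‖γ‖ * N') *
          (2 * ((2 * N + 1 : ℕ) : ℝ) ^ (t + 1) * t * (20 * Real.exp 1) ^ ((2 * N + 1) * t) *
              (M ^ t * Real.exp (‖γ‖ * (N + 1)) * ε) +
            BG * (1 / E) ^ ((2 * N + 1) * t)) + εc < 1 / (D x₁ τ : ℝ)) :
    ∀ x₁ : ℤ, |x₁| ≤ (N' : ℤ) → ∀ τ : Tau n, tauNorm τ + t ≤ Tlo → φ τ x₁ = 0 := by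
  intro x₁ hx₁ τ hτ
  have hM0 : 0 ≤ M := le_trans zero_le_one hM
  have hx₁n : ‖((x₁ : ℤ) : ℂ)‖ ≤ 3 * N + 2 := by
    rw [Complex.norm_intCast]
    have : (|x₁| : ℝ) ≤ N' := by exact_mod_cast hx₁
    have : ((N' : ℕ) : ℝ) ≤ 3 * N + 2 := by exact_mod_cast hN'
    linarith
  have hF := norm_le_of_taylor_jets_symm (hdiff τ hτ) γ N ht hM hε hE (hjet τ hτ) (hBG τ hτ) hx₁n
  set A : ℝ := 2 * ((2 * N + 1 : ℕ) : ℝ) ^ (t + 1) * t * (20 * Real.exp 1) ^ ((2 * N + 1) * t) *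
      (M ^ t * Real.exp (‖γ‖ * (N + 1)) * ε) + BG * (1 / E) ^ ((2 * N + 1) * t) with hA
  have hA0 : 0 ≤ A := by
    have hBG0 : 0 ≤ BG := le_trans (norm_nonneg _) (hBG τ hτ 0 (by simp; positivity))
    positivity
  have hexp : Real.exp (‖γ‖ * ‖((x₁ : ℤ) : ℂ)‖) ≤ Real.exp (‖γ‖ * N') := by
    refine Real.exp_le_exp.mpr (mul_le_mul_of_nonneg_left ?_ (norm_nonneg _))
    rw [Complex.norm_intCast]; exact_mod_cast hx₁
  have hF' : ‖F τ ((x₁ : ℤ) : ℂ)‖ ≤ Real.exp (‖γ‖ * N') * A :=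
    hF.trans (mul_le_mul_of_nonneg_right hexp hA0)
  have hφ : |((φ τ x₁ : ℚ) : ℝ)| ≤ Real.exp (‖γ‖ * N') * A + εc :=
    abs_ratCast_le_of_norm_sub_le' hF' (hcmp x₁ hx₁ τ hτ)
  exact rat_eq_zero_of_abs_lt' (hD x₁ τ) (hden x₁ τ) (lt_of_le_of_lt hφ (hfinal x₁ hx₁ τ hτ))

/-- **The archimedean k-step, odd nodes, Taylor-normalised jets** (twin of `G3Setup.LvInvI.kstep_odd`; Nesterenko's
`𝒳_{s,0} → 𝒳_{s,1}`): as `kstep_symm_taylor` with the jets at the ODD integers `|x| ≤ 2m − 1` (`m ≥ 1`), the growth bound on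
`‖z‖ ≤ (12E+6)m`, the new points `|x₁| ≤ N′ ≤ 6m`, and
`e^{‖γ‖N′}·(2(2m)^{t+1} t (20e)^{2mt}·2ᵗ(Mᵗ e^{2m‖γ‖} ε) + B_G E^{−2mt}) + ε_c < 1/D x₁ τ`.
[cite: Nesterenko2003, §4.2 Lemma 4.3 with the nodes 𝒳_{s,0}, p. 84–90] [cite: Waldschmidt1980, Lemma 3.6] -/
theorem kstep_odd_taylor (F : Tau n → ℂ → ℂ) {Tlo t : ℕ} (hdiff : ∀ τ, tauNorm τ + t ≤ Tlo → Differentiable ℂ (F τ))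
    (γ : ℂ) {m N' : ℕ} (hm : 1 ≤ m) (hN' : N' ≤ 6 * m) (ht : 1 ≤ t) {M ε εc BG E : ℝ} (hM : 1 ≤ M) (hε : 0 ≤ ε)
    (hE : 1 ≤ E) (φ : Tau n → ℤ → ℚ)
    (hjet : ∀ τ : Tau n, tauNorm τ + t ≤ Tlo → ∀ x : ℤ, Odd x → |x| ≤ 2 * (m : ℤ) - 1 → ∀ σ, σ < t →
      ‖iteratedDeriv σ (F τ) (x : ℂ)‖ ≤ σ.factorial * (M ^ σ * ε))
    (hBG : ∀ τ : Tau n, tauNorm τ + t ≤ Tlo →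
      ∀ z : ℂ, ‖z‖ ≤ (12 * E + 6) * m → ‖Complex.exp (γ * z) * F τ z‖ ≤ BG)
    (hcmp : ∀ x₁ : ℤ, |x₁| ≤ (N' : ℤ) → ∀ τ : Tau n, tauNorm τ + t ≤ Tlo →
      ‖F τ (x₁ : ℂ) - ((φ τ x₁ : ℚ) : ℂ)‖ ≤ εc)
    (D : ℤ → Tau n → ℕ) (hD : ∀ x τ, 1 ≤ D x τ) (hden : ∀ x τ, ∃ z : ℤ, (D x τ : ℚ) * φ τ x = z)
    (hfinal : ∀ x₁ : ℤ, |x₁| ≤ (N' : ℤ) → ∀ τ : Tau n, tauNorm τ + t ≤ Tlo →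
      Real.exp (‖γ‖ * N') *
          (2 * ((2 * m : ℕ) : ℝ) ^ (t + 1) * t * (20 * Real.exp 1) ^ ((2 * m) * t) *
              (2 ^ t * (M ^ t * Real.exp (‖γ‖ * (2 * m)) * ε)) +
            BG * (1 / E) ^ ((2 * m) * t)) + εc < 1 / (D x₁ τ : ℝ)) :
    ∀ x₁ : ℤ, |x₁| ≤ (N' : ℤ) → ∀ τ : Tau n, tauNorm τ + t ≤ Tlo → φ τ x₁ = 0 := by
  intro x₁ hx₁ τ hτ
  have hM0 : 0 ≤ M := le_trans zero_le_one hM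
  have hx₁n : ‖((x₁ : ℤ) : ℂ)‖ ≤ 6 * m := by
    rw [Complex.norm_intCast]
    have : (|x₁| : ℝ) ≤ N' := by exact_mod_cast hx₁
    have : ((N' : ℕ) : ℝ) ≤ 6 * m := by exact_mod_cast hN'
    linarith
  have hF := norm_le_of_taylor_jets_odd (hdiff τ hτ) γ hm ht hM hε hE (hjet τ hτ) (hBG τ hτ) hx₁n
  set A : ℝ := 2 * ((2 * m : ℕ) : ℝ) ^ (t + 1) * t * (20 * Real.exp 1) ^ ((2 * m) * t) *
      (2 ^ t * (M ^ t * Real.exp (‖γ‖ * (2 * m)) * ε)) + BG * (1 / E) ^ ((2 * m) * t) with hA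
  have hA0 : 0 ≤ A := by
    have hBG0 : 0 ≤ BG := le_trans (norm_nonneg _) (hBG τ hτ 0 (by simp; positivity))
    positivity
  have hexp : Real.exp (‖γ‖ * ‖((x₁ : ℤ) : ℂ)‖) ≤ Real.exp (‖γ‖ * N') := by
    refine Real.exp_le_exp.mpr (mul_le_mul_of_nonneg_left ?_ (norm_nonneg _))
    rw [Complex.norm_intCast]; exact_mod_cast hx₁
  have hF' : ‖F τ ((x₁ : ℤ) : ℂ)‖ ≤ Real.exp (‖γ‖ * N') * A :=
    hF.trans (mul_le_mul_of_nonneg_right hexp hA0)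
  have hφ : |((φ τ x₁ : ℚ) : ℝ)| ≤ Real.exp (‖γ‖ * N') * A + εc :=
    abs_ratCast_le_of_norm_sub_le' hF' (hcmp x₁ hx₁ τ hτ)
  exact rat_eq_zero_of_abs_lt' (hD x₁ τ) (hden x₁ τ) (lt_of_le_of_lt hφ (hfinal x₁ hx₁ τ hτ))

end ArchKStep

end Summit.ABC.StewartYu

end
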